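import Summits.QuantumFields.BalabanUV.Beta.StripArgumentPrinciple
import Summits.QuantumFields.BalabanUV.Beta.TubeHolAlgebra
import Summits.QuantumFields.BalabanUV.Beta.VertexToriSymmetry

/-!
# Beta / TubeZeroFree — THEOREM DB IN THE KERNEL: zero-freeness of a tube-holomorphic multiplier on the whole polystrip from
# zero-freeness on the VERTEX TORI plus one-dimensional winding certificates; the (Z1) binder `hdet` BY NAME
# (β sub-cell, BINDER-OWNERS row CAP-k, lineage `b2b-balaban-beta-an5`, gen 23; node BETA-an5-g23-THEOREM-DB, leaf 3; journal CLAIM l.14161)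

CAP-KERNEL §4.8 (xi) THEOREM DB (cap3, prose, cross-read cap-ref #8 §46; the tree's `TubeMaximumModulus` docstring: «(Z1) … is NOT
reduced to the vertex tori here (that needs winding numbers …) and stays a certificate on the period cell») — now a kernel theorem for
the tree's `TubeHol` multipliers, in the VERTEX-TORI currency of the (Z2) certificates:

* §1 slices `slice G i q z = G (insertNth i z q)` of a `TubeHol G w` multiplier (their strip data: continuity on the closed strip,
  holomorphy inside, `2π`-periodicity) and the (W) datum `SliceWindingEq G w i q` (equal increments of continuous logarithms of the
  slice along its two boundary lines `Im z = ±w i`, `WindingIncrement.IsContLog`; certified by compass words, `WindingWords`).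
* §2 TRANSFER of (W) along a straight segment of parameters on which the slice's boundary values stay zero-free
  (`SliceWindingEq.transfer`, by `LoopIncrement.incr_eq_of_family`).
* §3 **`TubeHol.ne_zero_of_face`** — the iterated argument principle: (F′) `G ≠ 0` at the tube points with ALL `|Im q_μ| = w_μ` and
  (W′) `SliceWindingEq` at every parameter on the boundary circles ⟹ `G ≠ 0` on the closed tube (Finset induction releasing one
  coordinate at a time, exactly as `TubeHol.norm_le_of_face`; each release is `StripArgumentPrinciple.ne_zero_of_strip` on the slice,
  its (W) input transferred from an all-circles reference parameter).
* §4 **`TubeHol.ne_zero_of_vertexTori`** — THEOREM DB: (F) `G ≠ 0` on `VertexTori w` + (W) ONE reference parameter per coordinate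
  `i` and sign pattern `s ∈ {±1}^d` ⟹ `G ≠ 0` on `Tube w`; **`MatTubeHol.det_ne_zero_of_vertexTori`** — THE (Z1) BINDER
  `hdet : ∀ p ∈ Strip (d+1) a, (A p).det ≠ 0` of `CapRouteA.rowsOfOneLoopFormCode16E_routeA₂` ∕ `TubeHolAlgebra.tubeHol_oneLoopForm`
  from `MatTubeHol A (fun _ => a)` + (F) for `det ∘ A` on the 2^{d+1} vertex tori + (W).
* §5 SYMMETRY: a coordinate reflection `reflectAt` leaving `G` invariant flips one sign of the pattern for free
  (`SliceWindingEq.reflect`); for a multiplier invariant under all coordinate reflections the d + 1 ALL-PLUS reference slices suffice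
  (`TubeHol.ne_zero_of_vertexTori_of_reflect` — cap3's «four windings» for the cell).

CONSEQUENCE FOR THE ROW (census V18 → KERNEL): under the L-CF branch the SAME box leaves that deliver (Z2a) `hBa` on a fundamental region
(`ResolventBoxCertificate.det_ne_zero_of_boxes` + `VertexToriSymmetry`; `TubeZeroFreeSymmetry.det_ne_zero_vertexTori_of_boxes_negConjRegion`)
deliver (F); (Z1) then costs (d+1)·2^d reference SLICES in general — d + 1 under all single reflections, 6 for the cell's `det k₀` under
R₂, R₃ + negation (`TubeZeroFreeSymmetry`) — each slice certified by TWO closed compass words (`TubeZeroFreeEnds.sliceWindingEq_of_words`;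
wording fixed after XREAD C-gan24leaf03-g34-1 NIT-1: the v1 text counted slices as «words»).

HONEST FRAMING.  Kernel complex analysis ([folklore]); no number, no binder INSTANCE for the cell's `k₀` (the box leaves and the words are
the engines' to produce).  Discharging `BetaPertH` would make Bałaban's ultraviolet stability unconditional — NOT the continuum limit, NOT
the Clay problem.  0 `sorry`, 0 cite tags.
-/

namespace Summit.QuantumFields.BalabanUV.Beta.TubeMaximumModulus

open Complex Set Metric Filter Topology
open Literature.MathematicalPhysics.QuantumFieldTheory.Balaban1983to89
open B4Strip (Strip)
open Summit.QuantumFields.BalabanUV.Beta.WindingIncrement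
open Summit.QuantumFields.BalabanUV.Beta.LoopIncrement
open Summit.QuantumFields.BalabanUV.Beta.StripArgumentPrinciple
open Summit.QuantumFields.BalabanUV.Beta.VertexToriSymmetry (reflectAt reflectAt_apply_same)
open scoped Real

noncomputable section

variable {d : ℕ} {G : (Fin (d + 1) → ℂ) → ℂ} {w : Fin (d + 1) → ℝ}

/-! ## §1 Slices of a tube-holomorphic multiplier and the (W) datum -/

/-- THE SLICE of `G` in coordinate `i` through the parameter `q ∈ ℂ^d`: `z ↦ G (insertNth i z q)`. [folklore] -/
def slice (G : (Fin (d + 1) → ℂ) → ℂ) (i : Fin (d + 1)) (q : Fin d → ℂ) : ℂ → ℂ := fun z => G (i.insertNth z q)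

/-- unfolding `slice`. [folklore] -/
@[simp] theorem slice_apply (G : (Fin (d + 1) → ℂ) → ℂ) (i : Fin (d + 1)) (q : Fin d → ℂ) (z : ℂ) :
    slice G i q z = G (i.insertNth z q) := rfl

/-- a slice through a tube parameter is continuous on the closed strip `|Im z| ≤ w i`. [folklore] -/
theorem TubeHol.continuousOn_slice (h : TubeHol G w) (i : Fin (d + 1)) {q : Fin d → ℂ}
    (hq : q ∈ Tube (fun j => w (i.succAbove j))) : ContinuousOn (slice G i q) (im ⁻¹' Icc (-(w i)) (w i)) := by
  have hc : Continuous (fun z : ℂ => (i.insertNth z q : Fin (d + 1) → ℂ)) :=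
    Continuous.finInsertNth i continuous_id continuous_const
  refine h.cont.comp hc.continuousOn fun z hz => ?_
  exact insertNth_mem_tube i hq (abs_le.mpr ⟨hz.1, hz.2⟩)

/-- … holomorphic on the open strip. [folklore] -/
theorem TubeHol.differentiableOn_slice (h : TubeHol G w) (i : Fin (d + 1)) {q : Fin d → ℂ}
    (hq : q ∈ Tube (fun j => w (i.succAbove j))) : DifferentiableOn ℂ (slice G i q) (im ⁻¹' Ioo (-(w i)) (w i)) :=
  h.diff i q hq

/-- … and `2π`-periodic. [folklore] -/
theorem TubeHol.slice_periodic (h : TubeHol G w) (i : Fin (d + 1)) (q : Fin d → ℂ) (z : ℂ) :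
    slice G i q (z + 2 * π) = slice G i q z :=
  h.periodic_slice i q z

/-- **THE (W) DATUM at coordinate `i` and parameter `q`**: continuous logarithms of the slice along its two boundary lines
`Im z = +w i` and `Im z = −w i` over the period `[−π, π]` have EQUAL increments (equal windings). [folklore] -/
def SliceWindingEq (G : (Fin (d + 1) → ℂ) → ℂ) (w : Fin (d + 1) → ℝ) (i : Fin (d + 1)) (q : Fin d → ℂ) : Prop :=
  ∃ Lp Lm : ℝ → ℂ, IsContLog (hEdge (slice G i q) (w i)) (-π) π Lp ∧ IsContLog (hEdge (slice G i q) (-(w i))) (-π) π Lm ∧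
    Lp π - Lp (-π) = Lm π - Lm (-π)

/-- (W) depends on the parameter only through the slice function. [folklore] -/
theorem SliceWindingEq.of_slice_eq {i : Fin (d + 1)} {q q' : Fin d → ℂ} (he : ∀ z, slice G i q' z = slice G i q z)
    (hW : SliceWindingEq G w i q) : SliceWindingEq G w i q' := by
  obtain ⟨Lp, Lm, hp, hm, e⟩ := hW
  exact ⟨Lp, Lm, hp.congr fun x _ => by simp only [hEdge_apply, he], hm.congr fun x _ => by simp only [hEdge_apply, he], e⟩

/-! ## §2 Transfer of (W) along a segment of parameters -/

/-- the straight segment between two parameters. [folklore] -/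
def seg (q₀ q₁ : Fin d → ℂ) (t : ℝ) : Fin d → ℂ := fun j => q₀ j + (t : ℂ) * (q₁ j - q₀ j)

/-- its start. [folklore] -/
@[simp] theorem seg_zero (q₀ q₁ : Fin d → ℂ) : seg q₀ q₁ 0 = q₀ := by funext j; simp [seg]

/-- its end. [folklore] -/
@[simp] theorem seg_one (q₀ q₁ : Fin d → ℂ) : seg q₀ q₁ 1 = q₁ := by funext j; simp [seg]

/-- imaginary parts along the segment. [folklore] -/
theorem seg_im (q₀ q₁ : Fin d → ℂ) (t : ℝ) (j : Fin d) :
    (seg q₀ q₁ t j).im = (1 - t) * (q₀ j).im + t * (q₁ j).im := by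
  simp [seg]; ring

/-- a coordinate on which the two parameters agree is constant along the segment. [folklore] -/
theorem seg_apply_of_eq {q₀ q₁ : Fin d → ℂ} {j : Fin d} (hj : q₁ j = q₀ j) (t : ℝ) : seg q₀ q₁ t j = q₀ j := by
  simp [seg, hj]

/-- a coordinate on which the imaginary parts agree keeps its imaginary part along the segment. [folklore] -/
theorem seg_im_of_eq {q₀ q₁ : Fin d → ℂ} {j : Fin d} (hj : (q₁ j).im = (q₀ j).im) (t : ℝ) : (seg q₀ q₁ t j).im = (q₀ j).im := by
  rw [seg_im, hj]; ring

/-- the segment between two tube parameters stays in the tube (convexity). [folklore] -/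
theorem seg_mem_tube {n : ℕ} {w' : Fin n → ℝ} {q₀ q₁ : Fin n → ℂ} (hq₀ : q₀ ∈ Tube w') (hq₁ : q₁ ∈ Tube w') {t : ℝ}
    (ht : t ∈ Icc (0 : ℝ) 1) : seg q₀ q₁ t ∈ Tube w' := by
  intro j
  rw [seg_im]
  have h0 := abs_le.mp (hq₀ j)
  have h1 := abs_le.mp (hq₁ j)
  have ht0 : 0 ≤ t := ht.1
  have ht1 : 0 ≤ 1 - t := by linarith [ht.2]
  refine abs_le.mpr ⟨?_, ?_⟩ <;> nlinarith [h0.1, h0.2, h1.1, h1.2]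

/-- continuity of `(t, x) ↦ insertNth i (x + is) (seg q₀ q₁ t)`. [folklore] -/
theorem continuous_insertNth_seg (i : Fin (d + 1)) (q₀ q₁ : Fin d → ℂ) (s : ℝ) :
    Continuous fun p : ℝ × ℝ => (i.insertNth ((p.2 : ℂ) + s * I) (seg q₀ q₁ p.1) : Fin (d + 1) → ℂ) := by
  refine Continuous.finInsertNth i ((continuous_ofReal.comp continuous_snd).add continuous_const) ?_
  refine continuous_pi fun j => ?_
  exact continuous_const.add ((continuous_ofReal.comp continuous_fst).mul continuous_const)

/-- **TRANSFER OF (W)**: if along the segment from `q₀` to `q₁` (both tube parameters) the boundary values of the slices stay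
zero-free, then (W) at `q₀` implies (W) at `q₁` (the two increments are constant along the segment by `incr_eq_of_family`). [folklore] -/
theorem SliceWindingEq.transfer (h : TubeHol G w) (i : Fin (d + 1)) (hwi : 0 ≤ w i) {q₀ q₁ : Fin d → ℂ}
    (hq₀ : q₀ ∈ Tube (fun j => w (i.succAbove j))) (hq₁ : q₁ ∈ Tube (fun j => w (i.succAbove j)))
    (hZ : ∀ t ∈ Icc (0 : ℝ) 1, ∀ x : ℝ, ∀ s : ℝ, |s| = w i → G (i.insertNth ((x : ℂ) + s * I) (seg q₀ q₁ t)) ≠ 0)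
    (h₀ : SliceWindingEq G w i q₀) : SliceWindingEq G w i q₁ := by
  obtain ⟨Lp, Lm, hLp, hLm, hW⟩ := h₀
  -- the two families (top `s = w i`, bottom `s = −w i`)
  have key : ∀ s : ℝ, |s| = w i → ∀ L₀ : ℝ → ℂ, IsContLog (hEdge (slice G i q₀) s) (-π) π L₀ →
      ∃ L₁ : ℝ → ℂ, IsContLog (hEdge (slice G i q₁) s) (-π) π L₁ ∧ L₀ π - L₀ (-π) = L₁ π - L₁ (-π) := by
    intro s hs L₀ hL₀
    set F : ℝ → ℝ → ℂ := fun t x => G (i.insertNth ((x : ℂ) + s * I) (seg q₀ q₁ t)) with hF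
    have hmem : ∀ t ∈ Icc (0 : ℝ) 1, ∀ x : ℝ, (i.insertNth ((x : ℂ) + s * I) (seg q₀ q₁ t) : Fin (d + 1) → ℂ) ∈ Tube w :=
      fun t ht x => insertNth_mem_tube i (seg_mem_tube hq₀ hq₁ ht) (by simpa using hs.le)
    have hFc : ContinuousOn (fun p : ℝ × ℝ => F p.1 p.2) (Icc 0 1 ×ˢ Icc (-π) π) :=
      h.cont.comp (continuous_insertNth_seg i q₀ q₁ s).continuousOn fun p hp => hmem p.1 hp.1 p.2
    have hFz : ∀ t ∈ Icc (0 : ℝ) 1, ∀ x ∈ Icc (-π) π, F t x ≠ 0 := fun t ht x _ => hZ t ht x s hs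
    have hFe : ∀ t ∈ Icc (0 : ℝ) 1, F t π = F t (-π) := by
      intro t _
      simp only [hF]
      have e := h.periodic_slice i (seg q₀ q₁ t) (((-π : ℝ) : ℂ) + s * I)
      rw [show ((-π : ℝ) : ℂ) + s * I + 2 * π = ((π : ℝ) : ℂ) + s * I by push_cast; ring] at e
      exact e
    have hc1 : ContinuousOn (F 1) (Icc (-π) π) :=
      hFc.comp (Continuous.prodMk_right (1 : ℝ)).continuousOn fun x hx => ⟨⟨zero_le_one, le_rfl⟩, hx⟩
    obtain ⟨L₁, hL₁⟩ := exists_isContLog hc1 fun x hx => hFz 1 ⟨zero_le_one, le_rfl⟩ x hx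
    have hL₀' : IsContLog (F 0) (-π) π L₀ := hL₀.congr fun x _ => by simp [hF]
    have e := incr_eq_of_family (F := F) (by linarith [Real.pi_pos]) hFc hFz hFe ⟨le_rfl, zero_le_one⟩
      ⟨zero_le_one, le_rfl⟩ hL₀' hL₁
    exact ⟨L₁, hL₁.congr fun x _ => by simp [hF], e⟩
  obtain ⟨Lp₁, hLp₁, ep⟩ := key (w i) (abs_of_nonneg hwi) Lp hLp
  obtain ⟨Lm₁, hLm₁, em⟩ := key (-(w i)) (by rw [abs_neg, abs_of_nonneg hwi]) Lm hLm
  exact ⟨Lp₁, Lm₁, hLp₁, hLm₁, by rw [← ep, ← em, hW]⟩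

/-! ## §3 The iterated argument principle (all real parts) -/

/-- coordinates of an inserted point outside a set avoiding `i`: bookkeeping for the induction. [folklore] -/
theorem insertNth_boundary {s : Finset (Fin (d + 1))} {i : Fin (d + 1)} {q : Fin d → ℂ} {z : ℂ}
    (hz : |z.im| = w i) (hq : ∀ k, i.succAbove k ∉ s → |(q k).im| = w (i.succAbove k)) :
    ∀ j, j ∉ s → |((i.insertNth z q : Fin (d + 1) → ℂ) j).im| = w j := by
  intro j hj
  refine Fin.succAboveCases i ?_ ?_ j hj
  · intro _; rw [Fin.insertNth_apply_same]; exact hz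
  · intro k hk; rw [Fin.insertNth_apply_succAbove]; exact hq k hk

/-- ONE RELEASE STEP: if `G ≠ 0` at every tube point whose coordinates outside `s` lie on their boundary circles, and (W′) holds at
every all-circles parameter, then the same holds with `s` enlarged by `i` (the strip argument principle on the `i`-slice; its (W)
input transferred from the reference parameter that lifts the released coordinates to their top circles). [folklore] -/
theorem TubeHol.ne_zero_step (h : TubeHol G w) (hw : ∀ μ, 0 < w μ)
    (hWs : ∀ (i : Fin (d + 1)) (q : Fin d → ℂ), (∀ j, |(q j).im| = w (i.succAbove j)) → SliceWindingEq G w i q)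
    (s : Finset (Fin (d + 1))) (i : Fin (d + 1))
    (hs : ∀ p ∈ Tube w, (∀ j, j ∉ s → |(p j).im| = w j) → G p ≠ 0) :
    ∀ p ∈ Tube w, (∀ j, j ∉ insert i s → |(p j).im| = w j) → G p ≠ 0 := by
  classical
  intro p hp hb
  by_cases hpi : |(p i).im| = w i
  · refine hs p hp fun j hj => ?_
    by_cases hji : j = i
    · rw [hji]; exact hpi
    · exact hb j (by rw [Finset.mem_insert, not_or]; exact ⟨hji, hj⟩)
  set q : Fin d → ℂ := i.removeNth p with hq_def
  have hq : q ∈ Tube (fun j => w (i.succAbove j)) := removeNth_mem_tube i hp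
  have hqb : ∀ k, i.succAbove k ∉ s → |(q k).im| = w (i.succAbove k) := by
    intro k hk
    rw [hq_def, Fin.removeNth_apply]
    exact hb _ fun hmem => by
      rcases Finset.mem_insert.mp hmem with h1 | h1
      · exact absurd h1 (Fin.succAbove_ne i k)
      · exact hk h1
  -- KEY FACT: for admissible parameters the slice boundary values are zero-free
  have hZ : ∀ q' : Fin d → ℂ, q' ∈ Tube (fun j => w (i.succAbove j)) →
      (∀ k, i.succAbove k ∉ s → |(q' k).im| = w (i.succAbove k)) → ∀ z : ℂ, |z.im| = w i → G (i.insertNth z q') ≠ 0 :=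
    fun q' hq' hqb' z hz => hs _ (insertNth_mem_tube i hq' hz.le) (insertNth_boundary hz hqb')
  -- the reference parameter: released coordinates lifted to their top circles
  set qr : Fin d → ℂ := fun k => if i.succAbove k ∈ s then ((q k).re : ℂ) + (w (i.succAbove k) : ℝ) * I else q k with hqr
  have hqr_im : ∀ k, |(qr k).im| = w (i.succAbove k) := by
    intro k
    by_cases hk : i.succAbove k ∈ s
    · simp only [hqr, hk, if_true]
      simp [abs_of_pos (hw _)]
    · simp only [hqr, hk, if_false]; exact hqb k hk
  have hqr_tube : qr ∈ Tube (fun j => w (i.succAbove j)) := fun k => (hqr_im k).le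
  have hqr_eq : ∀ k, i.succAbove k ∉ s → q k = qr k := fun k hk => by simp only [hqr, hk, if_false]
  -- (W) at `q`, transferred from `qr`
  have hWq : SliceWindingEq G w i q := by
    refine (hWs i qr hqr_im).transfer h i (hw i).le hqr_tube hq fun t ht x σ hσ => ?_
    have hzim : |(((x : ℂ) + σ * I)).im| = w i := by simpa using hσ
    refine hZ (seg qr q t) (seg_mem_tube hqr_tube hq ht) (fun k hk => ?_) ((x : ℂ) + σ * I) hzim
    rw [seg_apply_of_eq (hqr_eq k hk), hqr_im k]
  -- the strip argument principle on the slice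
  have hne := ne_zero_of_strip (f := slice G i q) (hw i) (h.continuousOn_slice i hq) (h.differentiableOn_slice i hq)
    (h.slice_periodic i q) (fun x => hZ q hq hqb _ (by simp [abs_of_pos (hw i)]))
    (fun x => hZ q hq hqb _ (by simp [abs_of_pos (hw i)])) hWq (p i) (abs_le.mp (hp i))
  rwa [slice_apply, hq_def, Fin.insertNth_self_removeNth] at hne

/-- **THE ITERATED ARGUMENT PRINCIPLE (all real parts)**: a tube-holomorphic `G` with (F′) `G ≠ 0` at the tube points with
`|Im q_μ| = w_μ` for EVERY `μ` and (W′) `SliceWindingEq` at every coordinate and every all-circles parameter has NO ZERO on the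
closed tube. [folklore] -/
theorem TubeHol.ne_zero_of_face (h : TubeHol G w) (hw : ∀ μ, 0 < w μ)
    (hF : ∀ p ∈ Tube w, (∀ μ, |(p μ).im| = w μ) → G p ≠ 0)
    (hWs : ∀ (i : Fin (d + 1)) (q : Fin d → ℂ), (∀ j, |(q j).im| = w (i.succAbove j)) → SliceWindingEq G w i q) :
    ∀ p ∈ Tube w, G p ≠ 0 := by
  classical
  suffices H : ∀ s : Finset (Fin (d + 1)), ∀ p ∈ Tube w, (∀ j, j ∉ s → |(p j).im| = w j) → G p ≠ 0 from
    fun p hp => H Finset.univ p hp fun j hj => absurd (Finset.mem_univ j) hj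
  intro s
  refine Finset.induction_on s (fun p hp hb => hF p hp fun μ => hb μ (Finset.notMem_empty μ)) ?_
  intro i s _ ih
  exact h.ne_zero_step hw hWs s i ih

/-! ## §4 THEOREM DB on the period cell and the (Z1) binder -/

/-- **THEOREM DB.**  A tube-holomorphic multiplier `G` (`TubeHol G w`, all `w_μ > 0`) with
(F) NO ZERO ON THE VERTEX TORI `|Re q_μ| ≤ π`, `|Im q_μ| = w_μ ∀μ`, and
(W) for every coordinate `i` and every sign pattern `s ∈ {±1}^d`, ONE parameter `q₀` on the `s`-signed boundary circles of the other
coordinates at which the slice `z ↦ G (insertNth i z q₀)` has equal windings along `Im z = ±w i` (`SliceWindingEq`),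
has NO ZERO on the whole closed tube `|Im q_μ| ≤ w_μ`. [folklore] -/
theorem TubeHol.ne_zero_of_vertexTori (h : TubeHol G w) (hw : ∀ μ, 0 < w μ) (hF : ∀ p ∈ VertexTori w, G p ≠ 0)
    (hW : ∀ (i : Fin (d + 1)) (s : Fin d → ℝ), (∀ j, s j = 1 ∨ s j = -1) →
      ∃ q₀ : Fin d → ℂ, (∀ j, (q₀ j).im = s j * w (i.succAbove j)) ∧ SliceWindingEq G w i q₀) :
    ∀ p ∈ Tube w, G p ≠ 0 := by
  -- (F′) from (F) by periodic reduction of the real parts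
  have hF' : ∀ p ∈ Tube w, (∀ μ, |(p μ).im| = w μ) → G p ≠ 0 := fun p _ hb => by
    rw [← h.apply_reduceRe p]; exact hF _ (reduceRe_mem_vertexTori hb)
  refine h.ne_zero_of_face hw hF' fun i q hq => ?_
  -- (W′) at an all-circles parameter `q` from the reference point of its sign class
  set s : Fin d → ℝ := fun j => (q j).im / w (i.succAbove j) with hs
  have hsj : ∀ j, s j = 1 ∨ s j = -1 := by
    intro j
    have hwj := hw (i.succAbove j)
    rcases (abs_eq hwj.le).mp (hq j) with e | e
    · left; rw [hs]; simp only; rw [e, div_self hwj.ne']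
    · right; rw [hs]; simp only; rw [e, neg_div, div_self hwj.ne']
  obtain ⟨q₀, hq₀, hW₀⟩ := hW i s hsj
  have him : ∀ j, (q j).im = (q₀ j).im := by
    intro j; rw [hq₀ j, hs]; simp only; rw [div_mul_cancel₀ _ (hw _).ne']
  have hq₀t : q₀ ∈ Tube (fun j => w (i.succAbove j)) := fun j => by rw [← him j]; exact (hq j).le
  have hqt : q ∈ Tube (fun j => w (i.succAbove j)) := fun j => (hq j).le
  refine hW₀.transfer h i (hw i).le hq₀t hqt fun t ht x σ hσ => ?_
  have hzim : |(((x : ℂ) + σ * I)).im| = w i := by simpa using hσ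
  refine hF' (i.insertNth ((x : ℂ) + σ * I) (seg q₀ q t)) (insertNth_mem_tube i (seg_mem_tube hq₀t hqt ht) hzim.le) ?_
  have hb := insertNth_boundary (s := ∅) (q := seg q₀ q t) hzim (fun k _ => by
    rw [seg_im_of_eq (him k), ← him k]; exact hq k)
  exact fun μ => hb μ (Finset.notMem_empty μ)

/-- the same conclusion read on the period cell `Strip (d+1) a` for equal half-widths. [folklore] -/
theorem TubeHol.ne_zero_strip_of_vertexTori {a : ℝ} (h : TubeHol G (fun _ => a)) (ha : 0 < a)
    (hF : ∀ p ∈ VertexTori (fun _ : Fin (d + 1) => a), G p ≠ 0)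
    (hW : ∀ (i : Fin (d + 1)) (s : Fin d → ℝ), (∀ j, s j = 1 ∨ s j = -1) →
      ∃ q₀ : Fin d → ℂ, (∀ j, (q₀ j).im = s j * a) ∧ SliceWindingEq G (fun _ => a) i q₀) :
    ∀ p ∈ Strip (d + 1) a, G p ≠ 0 :=
  fun p hp => h.ne_zero_of_vertexTori (fun _ => ha) hF hW p fun μ => (hp μ).2

/-- **THE (Z1) BINDER FROM VERTEX-TORI DATA**: for a tube-holomorphic matrix family `A` (`MatTubeHol A (fun _ => a)`, `0 < a` — automatic
for the cell's character-sum stencil families), (F) `det (A q) ≠ 0` on the 2^{d+1} vertex tori `|Im q_μ| = a` and (W) one winding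
certificate of `z ↦ det A (insertNth i z q₀)` per coordinate `i` and sign pattern give EXACTLY the hypothesis
`hdet : ∀ p ∈ Strip (d+1) a, (A p).det ≠ 0` of `CapRouteA.rowsOfOneLoopFormCode16E_routeA₂` ∕ `TubeHolAlgebra.tubeHol_oneLoopForm`. [folklore] -/
theorem MatTubeHol.det_ne_zero_of_vertexTori {n : Type*} [Fintype n] [DecidableEq n]
    {A : (Fin (d + 1) → ℂ) → Matrix n n ℂ} {a : ℝ} (hA : MatTubeHol A (fun _ => a)) (ha : 0 < a)
    (hF : ∀ p ∈ VertexTori (fun _ : Fin (d + 1) => a), (A p).det ≠ 0)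
    (hW : ∀ (i : Fin (d + 1)) (s : Fin d → ℝ), (∀ j, s j = 1 ∨ s j = -1) →
      ∃ q₀ : Fin d → ℂ, (∀ j, (q₀ j).im = s j * a) ∧ SliceWindingEq (fun p => (A p).det) (fun _ => a) i q₀) :
    ∀ p ∈ Strip (d + 1) a, (A p).det ≠ 0 :=
  hA.det.ne_zero_strip_of_vertexTori ha hF hW

/-! ## §5 Symmetry: coordinate reflections leaving `G` invariant flip signs of the pattern for free -/

/-- reflecting the full vector in the direction `succAbove i j` = reflecting the parameter's `j`-th coordinate. [folklore] -/
theorem reflectAt_succAbove_insertNth (i : Fin (d + 1)) (j : Fin d) (z : ℂ) (q : Fin d → ℂ) :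
    reflectAt (i.succAbove j) (i.insertNth z q) = i.insertNth z (Function.update q j (-q j)) := by
  funext μ
  refine Fin.succAboveCases i ?_ ?_ μ
  · rw [Fin.insertNth_apply_same, reflectAt, Function.update_of_ne (Fin.succAbove_ne i j).symm, Fin.insertNth_apply_same]
  · intro k
    rw [Fin.insertNth_apply_succAbove, reflectAt]
    by_cases hk : k = j
    · subst hk; rw [Function.update_self, Function.update_self, Fin.insertNth_apply_succAbove]
    · rw [Function.update_of_ne (fun e => hk (Fin.succAbove_right_injective e)), Function.update_of_ne hk,
        Fin.insertNth_apply_succAbove]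

/-- (W) transports along a coordinate reflection leaving `G` invariant: the pattern's `j`-th sign flips for free. [folklore] -/
theorem SliceWindingEq.reflect {i : Fin (d + 1)} (j : Fin d) (hR : ∀ p, G (reflectAt (i.succAbove j) p) = G p)
    {q : Fin d → ℂ} (hW : SliceWindingEq G w i q) : SliceWindingEq G w i (Function.update q j (-q j)) :=
  hW.of_slice_eq fun z => by rw [slice_apply, slice_apply, ← reflectAt_succAbove_insertNth, hR]

/-- **THEOREM DB FOR A REFLECTION-INVARIANT MULTIPLIER**: if `G (reflectAt ν p) = G p` for every coordinate `ν`, the (W) input reduces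
to the d + 1 ALL-PLUS reference slices `z ↦ G (insertNth i z (w ∘ succAbove i)·I)` (for the cell: cap3's «four windings»). [folklore] -/
theorem TubeHol.ne_zero_of_vertexTori_of_reflect (h : TubeHol G w) (hw : ∀ μ, 0 < w μ)
    (hF : ∀ p ∈ VertexTori w, G p ≠ 0) (hR : ∀ ν p, G (reflectAt ν p) = G p)
    (hW : ∀ i : Fin (d + 1), SliceWindingEq G w i fun j => ((w (i.succAbove j) : ℝ) : ℂ) * I) :
    ∀ p ∈ Tube w, G p ≠ 0 := by
  classical
  refine h.ne_zero_of_vertexTori hw hF fun i s hs => ?_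
  -- the reference point of the class `s`: purely imaginary, `Im = s_j · w_j`; reached from the all-plus point by reflections
  let qJ : Finset (Fin d) → Fin d → ℂ := fun J j => if j ∈ J then -(((w (i.succAbove j) : ℝ) : ℂ) * I) else ((w (i.succAbove j) : ℝ) : ℂ) * I
  have hJ : ∀ J : Finset (Fin d), SliceWindingEq G w i (qJ J) := by
    intro J
    induction J using Finset.induction_on with
    | empty => exact (hW i).of_slice_eq fun z => by simp [qJ]
    | insert j J hj ih =>
      have e : qJ (insert j J) = Function.update (qJ J) j (-qJ J j) := by
        funext k
        by_cases hk : k = j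
        · subst hk; simp [qJ, hj]
        · simp [qJ, hk]
      exact (ih.reflect j (hR (i.succAbove j))).of_slice_eq fun z => by rw [e]
  refine ⟨qJ (Finset.univ.filter fun j => s j = -1), fun j => ?_, hJ _⟩
  have hmem : (j ∈ Finset.univ.filter fun j => s j = -1) ↔ s j = -1 := by simp
  rcases hs j with e | e
  · have hn : ¬ s j = -1 := by rw [e]; norm_num
    have hq : qJ (Finset.univ.filter fun j => s j = -1) j = ((w (i.succAbove j) : ℝ) : ℂ) * I := by
      simp only [qJ]; rw [if_neg (hmem.not.mpr hn)]
    rw [hq, e]; simp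
  · have hq : qJ (Finset.univ.filter fun j => s j = -1) j = -(((w (i.succAbove j) : ℝ) : ℂ) * I) := by
      simp only [qJ]; rw [if_pos (hmem.mpr e)]
    rw [hq, e]; simp

end

end Summit.QuantumFields.BalabanUV.Beta.TubeMaximumModulus
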